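import Mathlib
import Literature.RepresentationTheory.FiniteGroups.IrreducibleCharacters

/-!
# `LieRankDesigns` (stmt-MatrixMultiplication-7614), line `Sketch`: stub D `stub_regularCount` — the regular-character count

Crux `Summit.MatrixMultiplication.MatrixMultiplication.Theses.LevelGradedCohnUmans.LieRankDesigns`; skeleton
`Cruxes/LieRankDesigns/Lines/Sketch.lean` (lead prover-line-stmt-MatrixMultiplication-7614-0, 7 registered stubs A–G);
this file proves the registered stub `stub_regularCount` verbatim (name + signature) and lands
`--supports stmt-MatrixMultiplication-7614`.

For a finite group `G` and a subgroup `H ≤ G`: `Σ_{χ ∈ Irr G} χ(1) · Σ_{h ∈ H} χ(h) = |G|`.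
Proof: the regular character `r_G` is a class function with `⟨r_G, χ⟩ = χ(1)` for every
irreducible `χ` (`classInner_leftRegular`), so its Fourier expansion
(`IsClassFun.eq_sum_classInner_smul`) reads `r_G = Σ_{χ ∈ Irr G} χ(1) χ`; summing over `h ∈ H`,
exchanging the two finite sums and using `r_G(h) = |G| [h = 1]` (`character_leftRegular`) with
`1 ∈ H` gives `|G|`.  Equivalently `Σ_χ d_χ · dim ρ_χ^H = [G : H]` (the permutation character
of `G/H`), which is how the skeleton uses it.
-/

set_option linter.dupNamespace false

noncomputable section

open scoped BigOperators
open Literature.RepresentationTheory.FiniteGroups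

namespace Summit.MatrixMultiplication.MatrixMultiplication.Theorems.LieRankDesigns

/-- `Σ_{χ ∈ Irr G} χ(1) χ(s) = r_G(s)`: the Fourier expansion of the regular character
(`⟨r_G, χ⟩ = χ(1)`, Serre §2.4 Cor. 1, in `IsClassFun.eq_sum_classInner_smul`, Serre §2.5 Thm. 6). -/
theorem sum_irrChars_degree_mul_apply {G : Type} [Group G] [Fintype G] (s : G) :
    ∑ χ ∈ (irrChars_finite_holds G).toFinset, χ 1 * χ s =
      (Representation.leftRegular ℂ G).character s := by
  have hcl : IsClassFun (Representation.leftRegular ℂ G).character :=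
    (isCharacter_leftRegular (G := G)).isClassFun
  conv_rhs => rw [hcl.eq_sum_classInner_smul]
  rw [Finset.sum_apply]
  refine Finset.sum_congr rfl fun χ _ => ?_
  rw [Pi.smul_apply, smul_eq_mul, classInner_leftRegular]

/-- **`Σ_{χ ∈ Irr G} χ(1) · Σ_{h ∈ H} χ(h) = |G|`** for a finite group `G` and a subgroup `H`
(registered stub D of line `Sketch`, statement `RegularCount`): the regular character summed
over `H`. -/
theorem stub_regularCount :
    ∀ (G : Type) [Group G] [Fintype G] (H : Subgroup G),
      ∑ᶠ χ ∈ irrChars G, χ 1 * ∑ᶠ h ∈ (H : Set G), χ h = (Fintype.card G : ℂ) := by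
  intro G _ _ H
  classical
  have hH : (H : Set G).Finite := Set.toFinite _
  have hinner : ∀ χ : G → ℂ, ∑ᶠ h ∈ (H : Set G), χ h = ∑ h ∈ hH.toFinset, χ h := fun χ =>
    finsum_mem_eq_finite_toFinset_sum χ hH
  rw [finsum_mem_eq_finite_toFinset_sum _ (irrChars_finite_holds G)]
  simp only [hinner, Finset.mul_sum]
  rw [Finset.sum_comm]
  simp only [sum_irrChars_degree_mul_apply, character_leftRegular]
  rw [Finset.sum_ite_eq' hH.toFinset (1 : G), if_pos (hH.mem_toFinset.mpr H.one_mem)]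

end Summit.MatrixMultiplication.MatrixMultiplication.Theorems.LieRankDesigns

end
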